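import Literature.Combinatorics.SimpleGraph.RamseyNumbers
import Summits.PneNP.PneNP.Theorems.RamseyUncertifiableResolutionUncertaintyTreeLike

/-!
# A tree-like resolution UNCERTAINTY PRINCIPLE for clique formulas — item stmt-PneNP-9816 (support)

`treeLike_uncertainty`: for EVERY graph `G` on `n ≥ 2^22` vertices, all `k₁, k₂`, and all TREE-LIKE resolution
refutations `π₁` of the unary `Clique(G, k₁)` and `π₂` of `Clique(Gᶜ, k₂)`:
`max(|π₁|, |π₂|) ≥ n^{(log₂ n)/9}` — explicit exponent, no Ramsey or density hypothesis, no core.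

This is the item's inequality (`n^{ε log₂ n} ≤ max(|π₁|,|π₂|)`, there at `k = ⌈log₂ n²⌉` and for dag-like
refutations — the open problem) in the tree-like case with `ε = 1/9`, for all `n ≥ 2^22`; it complements
`treeLike_resolutionUncertainty` (…TreeLikeRung.lean: one-sided conclusion `|π₁| ≥ n^{ε log₂ n}` via the Prömel–Rödl
core, tiny `ε`). Proof: Erdős–Szekeres COUNTED (`choose_le_card_homogeneous_mul`: every `C(2t,t)`-set of vertices
contains a homogeneous `(t+1)`-set, tree: `Literature.Combinatorics.SimpleGraph.exists_clique_or_indep_of_choose_le_card`,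
and each `(t+1)`-set lies in `C(n-t-1, ·)` of them, so `C(n,t+1) ≤ (#cliques + #cocliques)·C(C(2t,t), t+1)`); with
`t = ⌊log₂ n/4⌋` this is `≥ 2^{log₂² n/8 - log₂ n/4}` homogeneous sets (`two_rpow_le_card_homogeneous`); tree-like
refutations enumerate cliques (`treelike_cliqueCNF_length_ge_card_cliqueFinset`, on `G` and on `Gᶜ`).
The standing disproof bounds the dag-like exponent from above by `1/2 + o(1)` on random graphs; for tree-like
refutations the truth therefore lies in `[1/9, 1/2]·log₂ n` (brute force is tree-like).
-/

set_option linter.dupNamespace false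

namespace Summit.PneNP.PneNP.Theorems.RamseyUncertifiableResolutionUncertainty

open Literature.Computability.Complexity Literature.Computability.MetaComplexity
open Summit.PneNP.PneNP.Theorems.RegularResolutionRung.Negative (cliqueCNF)

/-! ## Erdős–Szekeres counting: every graph has many homogeneous sets -/

section Homogeneous

variable {n : ℕ} (G : SimpleGraph (Fin n)) [DecidableRel G.Adj]

/-- `t + 1 ≤ C(2t, t)` for `t ≥ 1`. -/
theorem succ_le_choose_two_mul {t : ℕ} (ht : 1 ≤ t) : t + 1 ≤ (2 * t).choose t := by
  calc t + 1 ≤ 2 * t := by omega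
    _ = (2 * t).choose 1 := (Nat.choose_one_right _).symm
    _ ≤ (2 * t).choose t := by
        have := Nat.choose_le_middle 1 (2 * t)
        rwa [show 2 * t / 2 = t by omega] at this

/-- **Many homogeneous sets (Erdős–Szekeres, counted).** For every graph `G` on `Fin n` and every `t` with
`C(2t, t) ≤ n`: `C(n, t+1) ≤ (#(t+1)-cliques of G + #(t+1)-cliques of Gᶜ) · C(C(2t,t), t+1)` — every
`C(2t,t)`-subset contains a homogeneous `(t+1)`-set, and a `(t+1)`-set lies in `C(n-t-1, C(2t,t)-t-1)` of them. -/
theorem choose_le_card_homogeneous_mul (t : ℕ) (ht : 1 ≤ t) (hN : (2 * t).choose t ≤ n) :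
    n.choose (t + 1) ≤
      ((G.cliqueFinset (t + 1)).card + (Gᶜ.cliqueFinset (t + 1)).card) * ((2 * t).choose t).choose (t + 1) := by
  classical
  set N := (2 * t).choose t with hNdef
  set W : Finset (Finset (Fin n)) := Finset.univ.powersetCard N with hW
  set H : Finset (Finset (Fin n)) := G.cliqueFinset (t + 1) ∪ Gᶜ.cliqueFinset (t + 1) with hH
  -- double counting on `r h w := h ⊆ w`
  have hdc : W.card * 1 ≤ H.card * (n - (t + 1)).choose (N - (t + 1)) := by
    refine Finset.card_mul_le_card_mul (r := fun w h => h ⊆ w) (fun w hw => ?_) (fun h hh => ?_)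
    · -- every `N`-set contains a homogeneous `(t+1)`-set
      obtain ⟨-, hwcard⟩ := Finset.mem_powersetCard.1 hw
      have hle : (t + t).choose t ≤ w.card := by rw [hwcard, hNdef, two_mul]
      rcases Literature.Combinatorics.SimpleGraph.exists_clique_or_indep_of_choose_le_card G (t + t) t t rfl w hle
        with ⟨s, hs, hcl⟩ | ⟨s, hs, hcl⟩
      · refine Finset.card_pos.2 ⟨s, ?_⟩
        rw [Finset.mem_bipartiteAbove]
        exact ⟨Finset.mem_union_left _ (SimpleGraph.mem_cliqueFinset_iff.2 hcl), hs⟩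
      · refine Finset.card_pos.2 ⟨s, ?_⟩
        rw [Finset.mem_bipartiteAbove]
        exact ⟨Finset.mem_union_right _ (SimpleGraph.mem_cliqueFinset_iff.2 hcl), hs⟩
    · -- a `(t+1)`-set lies in at most `C(n-(t+1), N-(t+1))` of the `N`-sets
      have hcard : h.card = t + 1 := by
        rcases Finset.mem_union.1 hh with hh | hh
        · exact (SimpleGraph.mem_cliqueFinset_iff.1 hh).card_eq
        · exact (SimpleGraph.mem_cliqueFinset_iff.1 hh).card_eq
      calc (W.bipartiteBelow (fun w h => h ⊆ w) h).card
          ≤ ((Finset.univ \ h).powersetCard (N - (t + 1))).card := by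
            refine Finset.card_le_card_of_injOn (fun w => w \ h) (fun w hw => ?_) ?_
            · rw [Finset.mem_coe, Finset.mem_bipartiteBelow] at hw
              obtain ⟨hwW, hhw⟩ := hw
              obtain ⟨-, hwcard⟩ := Finset.mem_powersetCard.1 hwW
              rw [Finset.mem_coe, Finset.mem_powersetCard]
              refine ⟨Finset.sdiff_subset_sdiff (Finset.subset_univ _) le_rfl, ?_⟩
              rw [Finset.card_sdiff_of_subset hhw, hwcard, hcard]
            · intro w hw w' hw' heq
              rw [Finset.mem_coe, Finset.mem_bipartiteBelow] at hw hw'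
              have h1 : w = (w \ h) ∪ h := (Finset.sdiff_union_of_subset hw.2).symm
              have h2 : w' = (w' \ h) ∪ h := (Finset.sdiff_union_of_subset hw'.2).symm
              rw [h1, h2]
              exact congrArg (· ∪ h) heq
        _ = (n - (t + 1)).choose (N - (t + 1)) := by
            rw [Finset.card_powersetCard, Finset.card_sdiff_of_subset (Finset.subset_univ _), Finset.card_univ,
              Fintype.card_fin, hcard]
  rw [mul_one, hW, Finset.card_powersetCard, Finset.card_univ, Fintype.card_fin] at hdc
  -- `C(n,N) C(N,t+1) = C(n,t+1) C(n-(t+1), N-(t+1))`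
  have hq : t + 1 ≤ N := by rw [hNdef]; exact succ_le_choose_two_mul ht
  have hpos : 0 < (n - (t + 1)).choose (N - (t + 1)) := Nat.choose_pos (by omega)
  have key : n.choose (t + 1) * (n - (t + 1)).choose (N - (t + 1)) ≤
      (H.card * N.choose (t + 1)) * (n - (t + 1)).choose (N - (t + 1)) := by
    calc n.choose (t + 1) * (n - (t + 1)).choose (N - (t + 1))
        = n.choose N * N.choose (t + 1) := (Nat.choose_mul (n := n) hq).symm
      _ ≤ H.card * (n - (t + 1)).choose (N - (t + 1)) * N.choose (t + 1) := Nat.mul_le_mul_right _ hdc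
      _ = (H.card * N.choose (t + 1)) * (n - (t + 1)).choose (N - (t + 1)) := by ring
  have := Nat.le_of_mul_le_mul_right key hpos
  calc n.choose (t + 1) ≤ H.card * N.choose (t + 1) := this
    _ ≤ _ := Nat.mul_le_mul_right _ (Finset.card_union_le _ _)

/-- The count in exponential form: for `n ≥ 2^{22}` and `t = ⌊log₂ n / 4⌋`, writing `L = log₂ n`,
`2^{L²/8 - L/4} ≤ #(t+1)-cliques of G + #(t+1)-cliques of Gᶜ`. -/
theorem two_rpow_le_card_homogeneous (hn : 2 ^ 22 ≤ n) :
    (2 : ℝ) ^ (Real.logb 2 n ^ 2 / 8 - Real.logb 2 n / 4) ≤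
      ((G.cliqueFinset (⌊Real.logb 2 n / 4⌋₊ + 1)).card : ℝ) +
        ((Gᶜ.cliqueFinset (⌊Real.logb 2 n / 4⌋₊ + 1)).card : ℝ) := by
  set L := Real.logb 2 (n : ℝ) with hLdef
  set t : ℕ := ⌊L / 4⌋₊ with htdef
  set q : ℕ := t + 1 with hqdef
  set N : ℕ := (2 * t).choose t with hNdef
  have hn1 : (1 : ℝ) ≤ n := by exact_mod_cast le_trans (by norm_num) (le_trans (Nat.one_le_two_pow) hn)
  have hnpos : (0 : ℝ) < n := by linarith
  have hn2 : (n : ℝ) = 2 ^ L := (Real.rpow_logb two_pos (by norm_num) hnpos).symm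
  have hL22 : 22 ≤ L := by
    have : (2 : ℝ) ^ (22 : ℝ) ≤ n := by
      rw [show (22 : ℝ) = ((22 : ℕ) : ℝ) by norm_num, Real.rpow_natCast]
      exact_mod_cast hn
    have := Real.logb_le_logb_of_le (b := 2) one_lt_two (by positivity) this
    rwa [Real.logb_rpow two_pos (by norm_num)] at this
  have hL0 : 0 ≤ L := by linarith
  -- `t ≤ L/4 < t + 1`, so `q ≥ L/4` and `t ≥ 5`
  have htle : (t : ℝ) ≤ L / 4 := Nat.floor_le (by positivity)
  have hqge : L / 4 ≤ (q : ℝ) := by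
    have := Nat.lt_floor_add_one (L / 4)
    rw [hqdef]; push_cast; rw [← htdef] at this; linarith
  have ht1 : 1 ≤ t := by
    rw [htdef, Nat.one_le_floor_iff]; linarith
  -- `N ≤ 4^t = 2^{2t} ≤ 2^{L/2}`
  have hNle : (N : ℝ) ≤ (2 : ℝ) ^ (L / 2) := by
    have h1 : N ≤ 2 ^ (2 * t) := Nat.choose_le_two_pow _ _
    calc (N : ℝ) ≤ ((2 ^ (2 * t) : ℕ) : ℝ) := by exact_mod_cast h1
      _ = (2 : ℝ) ^ ((2 * t : ℕ) : ℝ) := by rw [Real.rpow_natCast]; push_cast; ring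
      _ ≤ (2 : ℝ) ^ (L / 2) := Real.rpow_le_rpow_of_exponent_le one_le_two (by push_cast; linarith)
  have hNn : N ≤ n := by
    have : (N : ℝ) ≤ n := by
      calc (N : ℝ) ≤ (2 : ℝ) ^ (L / 2) := hNle
        _ ≤ (2 : ℝ) ^ L := Real.rpow_le_rpow_of_exponent_le one_le_two (by linarith)
        _ = n := hn2.symm
    exact_mod_cast this
  -- the ℕ chain: `(n+1-q)^q ≤ (A+B) · N^q`
  set A := (G.cliqueFinset q).card with hA
  set B := (Gᶜ.cliqueFinset q).card with hB
  have hcount : n.choose q ≤ (A + B) * N.choose q := choose_le_card_homogeneous_mul G t ht1 hNn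
  have hchain : (n + 1 - q) ^ q ≤ (A + B) * N ^ q := by
    calc (n + 1 - q) ^ q ≤ n.descFactorial q := Nat.pow_sub_le_descFactorial n q
      _ = q.factorial * n.choose q := Nat.descFactorial_eq_factorial_mul_choose n q
      _ ≤ q.factorial * ((A + B) * N.choose q) := Nat.mul_le_mul_left _ hcount
      _ = (A + B) * (q.factorial * N.choose q) := by ring
      _ = (A + B) * N.descFactorial q := by rw [Nat.descFactorial_eq_factorial_mul_choose]
      _ ≤ (A + B) * N ^ q := Nat.mul_le_mul_left _ (Nat.descFactorial_le_pow N q)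
  -- to ℝ: `2^{(L-1) q} ≤ (n+1-q)^q ≤ (A+B) N^q ≤ (A+B) 2^{(L/2) q}`
  -- `q ≤ N ≤ 2^{L/2} ≤ 2^{L-1} = n/2`
  have h3 : (2 : ℝ) ^ (L - 1) = n / 2 := by
    rw [Real.rpow_sub two_pos, Real.rpow_one, ← hn2]
  have hqN : q ≤ N := by rw [hqdef, hNdef]; exact succ_le_choose_two_mul ht1
  have hq_half : (q : ℝ) ≤ (n : ℝ) / 2 := by
    calc (q : ℝ) ≤ N := by exact_mod_cast hqN
      _ ≤ (2 : ℝ) ^ (L / 2) := hNle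
      _ ≤ (2 : ℝ) ^ (L - 1) := Real.rpow_le_rpow_of_exponent_le one_le_two (by linarith)
      _ = n / 2 := h3
  have hbase : (2 : ℝ) ^ (L - 1) ≤ ((n + 1 - q : ℕ) : ℝ) := by
    have hqn : q ≤ n + 1 := by
      have : (q : ℝ) ≤ n + 1 := by linarith
      exact_mod_cast this
    rw [Nat.cast_sub hqn]
    push_cast
    rw [h3]; linarith
  have hreal : (2 : ℝ) ^ ((L - 1) * q) ≤ (A + B : ℝ) * (2 : ℝ) ^ (L / 2 * q) := by
    have h1 : ((2 : ℝ) ^ (L - 1)) ^ q ≤ (((n + 1 - q : ℕ) : ℝ)) ^ q := pow_le_pow_left₀ (by positivity) hbase q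
    have h2 : (((n + 1 - q : ℕ) : ℝ)) ^ q ≤ (A + B : ℝ) * (N : ℝ) ^ q := by
      have := (Nat.cast_le (α := ℝ)).2 hchain
      push_cast [Nat.cast_pow] at this
      exact this
    have h3 : (A + B : ℝ) * (N : ℝ) ^ q ≤ (A + B : ℝ) * ((2 : ℝ) ^ (L / 2)) ^ q :=
      mul_le_mul_of_nonneg_left (pow_le_pow_left₀ (Nat.cast_nonneg N) hNle q)
        (add_nonneg (Nat.cast_nonneg A) (Nat.cast_nonneg B))
    rw [Real.rpow_mul_natCast (by norm_num), Real.rpow_mul_natCast (by norm_num)]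
    exact (h1.trans h2).trans h3
  -- divide: `A + B ≥ 2^{(L-1)q - (L/2)q} = 2^{(L/2-1) q} ≥ 2^{(L/2-1) L/4}`
  have hAB : (2 : ℝ) ^ ((L / 2 - 1) * q) ≤ (A + B : ℝ) := by
    have hpos : (0 : ℝ) < (2 : ℝ) ^ (L / 2 * q) := by positivity
    have : (2 : ℝ) ^ ((L / 2 - 1) * q) * (2 : ℝ) ^ (L / 2 * q) = (2 : ℝ) ^ ((L - 1) * q) := by
      rw [← Real.rpow_add two_pos]; ring_nf
    rw [← this] at hreal
    exact le_of_mul_le_mul_right hreal hpos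
  have hexp : L ^ 2 / 8 - L / 4 ≤ (L / 2 - 1) * q := by
    have : L ^ 2 / 8 - L / 4 = (L / 2 - 1) * (L / 4) := by ring
    rw [this]
    exact mul_le_mul_of_nonneg_left hqge (by linarith)
  calc (2 : ℝ) ^ (L ^ 2 / 8 - L / 4) ≤ (2 : ℝ) ^ ((L / 2 - 1) * q) := Real.rpow_le_rpow_of_exponent_le one_le_two hexp
    _ ≤ (A + B : ℝ) := hAB
    _ = _ := by rw [hA, hB]

end Homogeneous

/-! ## The tree-like uncertainty principle -/

/-- **Tree-like resolution uncertainty, every graph, explicit exponent.** For `n ≥ 2^{22}`, every graph `G` on `Fin n`,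
all `k₁ k₂`, and every pair of TREE-LIKE resolution refutations `π₁` of `Clique(G, k₁)` and `π₂` of `Clique(Gᶜ, k₂)`:
`max(|π₁|, |π₂|) ≥ n^{(log₂ n)/9}`. (Erdős–Szekeres counted: `G` or `Gᶜ` has `≥ 2^{log₂² n/8 - O(log n)}` cliques of
size `⌊log₂ n/4⌋ + 1`; tree-like refutations enumerate cliques.) No Ramsey hypothesis is needed: if one side has a
large clique it has no refutation and the statement is vacuous there. -/
theorem treeLike_uncertainty :
    ∀ (n : ℕ), 2 ^ 22 ≤ n → ∀ (G : SimpleGraph (Fin n)) [DecidableRel G.Adj] (k₁ k₂ : ℕ) (π₁ π₂ : List (ResLine ℕ)),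
      IsResRefutation (cliqueCNF n k₁ fun u v => decide (G.Adj u v)) π₁ → IsTreeLike π₁ →
      IsResRefutation (cliqueCNF n k₂ fun u v => decide (Gᶜ.Adj u v)) π₂ → IsTreeLike π₂ →
        (n : ℝ) ^ (Real.logb 2 n / 9) ≤ max (π₁.length : ℝ) (π₂.length : ℝ) := by
  intro n hn G _ k₁ k₂ π₁ π₂ h₁ ht₁ h₂ ht₂
  set L := Real.logb 2 (n : ℝ) with hLdef
  set q : ℕ := ⌊L / 4⌋₊ + 1 with hqdef
  have hn1 : (1 : ℝ) ≤ n := by exact_mod_cast le_trans (by norm_num) (le_trans (Nat.one_le_two_pow) hn)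
  have hnpos : (0 : ℝ) < n := by linarith
  have hL22 : 22 ≤ L := by
    have : (2 : ℝ) ^ (22 : ℝ) ≤ n := by
      rw [show (22 : ℝ) = ((22 : ℕ) : ℝ) by norm_num, Real.rpow_natCast]
      exact_mod_cast hn
    have := Real.logb_le_logb_of_le (b := 2) one_lt_two (by positivity) this
    rwa [Real.logb_rpow two_pos (by norm_num)] at this
  have hcount := two_rpow_le_card_homogeneous G hn
  have hA : ((G.cliqueFinset q).card : ℝ) ≤ π₁.length := by exact_mod_cast treelike_cliqueCNF_length_ge_card_cliqueFinset G π₁ q h₁ ht₁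
  have hB : ((Gᶜ.cliqueFinset q).card : ℝ) ≤ π₂.length := by exact_mod_cast treelike_cliqueCNF_length_ge_card_cliqueFinset Gᶜ π₂ q h₂ ht₂
  have hsum : (2 : ℝ) ^ (L ^ 2 / 8 - L / 4) ≤ 2 * max (π₁.length : ℝ) (π₂.length : ℝ) := by
    calc (2 : ℝ) ^ (L ^ 2 / 8 - L / 4) ≤ ((G.cliqueFinset q).card : ℝ) + ((Gᶜ.cliqueFinset q).card : ℝ) := hcount
      _ ≤ π₁.length + π₂.length := add_le_add hA hB
      _ ≤ 2 * max (π₁.length : ℝ) (π₂.length : ℝ) := by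
          have := le_max_left (π₁.length : ℝ) (π₂.length : ℝ)
          have := le_max_right (π₁.length : ℝ) (π₂.length : ℝ)
          linarith
  -- `n^{L/9} = 2^{L²/9} ≤ 2^{L²/8 - L/4 - 1} ≤ max`
  have hexp : L * (L / 9) ≤ L ^ 2 / 8 - L / 4 - 1 := by nlinarith
  calc (n : ℝ) ^ (L / 9) = (2 : ℝ) ^ (L * (L / 9)) := by
        rw [← Real.rpow_logb two_pos (by norm_num) hnpos, ← Real.rpow_mul (by norm_num)]
    _ ≤ (2 : ℝ) ^ (L ^ 2 / 8 - L / 4 - 1) := Real.rpow_le_rpow_of_exponent_le one_le_two hexp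
    _ = (2 : ℝ) ^ (L ^ 2 / 8 - L / 4) / 2 := by
        rw [Real.rpow_sub two_pos, Real.rpow_one]
    _ ≤ max (π₁.length : ℝ) (π₂.length : ℝ) := by linarith

end Summit.PneNP.PneNP.Theorems.RamseyUncertifiableResolutionUncertainty
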